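import Mathlib
import Summits.ValiantsHypothesis.ValiantsHypothesis.Theses.LiouvilleSarnak
import Summits.ValiantsHypothesis.ValiantsHypothesis.Theorems.LiouvilleSarnakDigitalBilinearLiouvilleTtStarFourthMoment

/-!
# Route LiouvilleSarnak — crux `DigitalBilinearLiouville` (stmt-ValiantsHypothesis-14774), line
# `tt_star`: the open stub `stub_twoPointDigital` is EQUIVALENT to the crux

The registered line `Cruxes/DigitalBilinearLiouville/Lines/tt_star.lean` has two stubs:
`stub_fourthMoment` (linear algebra; PROVED in
`Theorems/LiouvilleSarnakDigitalBilinearLiouvilleTtStarFourthMoment.lean`) and the arithmetic stub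
`stub_twoPointDigital` — for every `ε > 0`, all large `n` and every balanced cut `π`,
`Σ_{r,r'} ‖Σ_c λ(N_π(r,c)+1) λ(N_π(r',c)+1)‖² ≤ ε 16^n` (the Frobenius norm of the Gram matrix
`M_π M_π^*` of the cut matrix).  The line card labels this stub "crux-EQUIVALENT up to `ε ↔ ε²`";
this file makes that label a theorem, so that the planner's books show the line for what it is —
a REFORMULATION of the crux in test-vector-free (pair-correlation) currency, not a weakening:

* §1 from a bilinear bound `‖Σ u_r w_c M_{rc}‖² ≤ C ‖u‖² ‖w‖²` (all `u, w`) to the row-sum bound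
  `Σ_r ‖Σ_c M_{rc} w_c‖² ≤ C ‖w‖²` (test `u = conj(M w)`), and to the Gram/Frobenius bound
  `Σ_{r,r'} ‖Σ_c M_{rc} conj(M_{r'c})‖² ≤ C Σ_{r',c} ‖M_{r'c}‖²` (apply the row-sum bound to each
  `w = conj(row r')`);
* §2 `twoPointDigital_of_digitalBilinearLiouville`: the crux at `ε` gives the stub at `ε`
  (`C = ε 4^n`, `Σ_{r',c} ‖M_{r'c}‖² = 4^n` since every entry is `λ` of a positive integer);
* §3 `digitalBilinearLiouville_of_twoPointDigital`: the stub at `ε²` gives the crux at `ε`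
  (the skeleton's kernel-checked composition with the landed `stub_fourthMoment`);
* §4 `digitalBilinearLiouville_iff_twoPointDigital`.

Honest framing: structural bookkeeping for a registered line; the crux `DigitalBilinearLiouville`
(Type-II bound for `λ` on adversarial digital rectangles at modulus `√X`), its pair-correlation
form, `LiouvilleCutRank` and `AlgebraicSarnak` stay OPEN, and nothing here bears on VP versus VNP.
No definitions (the stub's statement is written out verbatim in the theorem types).
-/

-- the directory `ValiantsHypothesis/ValiantsHypothesis` repeats the summit name (tree layout)
set_option linter.dupNamespace false

namespace Summit.ValiantsHypothesis.ValiantsHypothesis.Theorems.LiouvilleSarnakDigitalBilinearLiouville.TtStar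

open Summit.ValiantsHypothesis.ValiantsHypothesis.Theses.LiouvilleSarnak

/-! ### §1 From a bilinear bound to the Gram / Frobenius bound -/

/-- **Row-sum bound from a bilinear bound.**  If `‖Σ_r Σ_c u_r w_c M_{rc}‖² ≤ C ‖u‖² ‖w‖²` for all
test vectors `u, w`, then `Σ_r ‖Σ_c M_{rc} w_c‖² ≤ C ‖w‖²` for every `w` (test with
`u = conj(M w)`). [folklore] -/
theorem sum_norm_rowSum_sq_le_of_bilinear {ι κ : Type*} [Fintype ι] [Fintype κ]
    (M : ι → κ → ℂ) (C : ℝ) (hC : 0 ≤ C)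
    (hB : ∀ (u : ι → ℂ) (w : κ → ℂ),
      ‖∑ r, ∑ c, u r * w c * M r c‖ ^ 2 ≤ C * (∑ r, ‖u r‖ ^ 2) * (∑ c, ‖w c‖ ^ 2))
    (w : κ → ℂ) : ∑ r, ‖∑ c, M r c * w c‖ ^ 2 ≤ C * ∑ c, ‖w c‖ ^ 2 := by
  set v : ι → ℂ := fun r => ∑ c, M r c * w c with hv
  set S : ℝ := ∑ r, ‖v r‖ ^ 2 with hS
  have hsum : ∑ r, ∑ c, star (v r) * w c * M r c = (S : ℂ) := by
    have hrow : ∀ r, ∑ c, star (v r) * w c * M r c = v r * star (v r) := by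
      intro r
      rw [mul_comm (v r), hv, Finset.mul_sum]
      exact Finset.sum_congr rfl fun c _ => by ring
    simp_rw [hrow]
    rw [hS, ofReal_sum_norm_sq]
  have h := hB (fun r => star (v r)) w
  rw [hsum, Complex.norm_real, Real.norm_of_nonneg (by positivity)] at h
  simp only [norm_star] at h
  have hS0 : 0 ≤ S := by positivity
  have hW0 : 0 ≤ ∑ c, ‖w c‖ ^ 2 := by positivity
  rcases hS0.eq_or_lt with h0 | hpos
  · rw [← h0]; positivity
  · have h' : S * S ≤ (C * ∑ c, ‖w c‖ ^ 2) * S := by nlinarith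
    exact le_of_mul_le_mul_right h' hpos

/-- **Gram / Frobenius bound from a bilinear bound.**  If `‖Σ_r Σ_c u_r w_c M_{rc}‖² ≤ C ‖u‖² ‖w‖²`
for all `u, w`, then `‖M M^*‖_F² = Σ_{r,r'} ‖Σ_c M_{rc} conj(M_{r'c})‖² ≤ C Σ_{r',c} ‖M_{r'c}‖²`
(the row-sum bound at `w = conj(row r')`, summed over `r'`). [folklore] -/
theorem gram_frobenius_sq_le_of_bilinear {ι κ : Type*} [Fintype ι] [Fintype κ]
    (M : ι → κ → ℂ) (C : ℝ) (hC : 0 ≤ C)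
    (hB : ∀ (u : ι → ℂ) (w : κ → ℂ),
      ‖∑ r, ∑ c, u r * w c * M r c‖ ^ 2 ≤ C * (∑ r, ‖u r‖ ^ 2) * (∑ c, ‖w c‖ ^ 2)) :
    ∑ r, ∑ r', ‖∑ c, M r c * star (M r' c)‖ ^ 2 ≤ C * ∑ r', ∑ c, ‖M r' c‖ ^ 2 := by
  rw [Finset.sum_comm, Finset.mul_sum]
  refine Finset.sum_le_sum fun r' _ => ?_
  have h := sum_norm_rowSum_sq_le_of_bilinear M C hC hB (fun c => star (M r' c))
  simpa only [norm_star] using h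

/-! ### §2 The crux implies the stub (same `ε`) -/

/-- Every entry of a Liouville digital cut matrix has norm `1` (`λ` of a positive integer is `±1`).
[folklore] -/
theorem norm_liouville_succ_cast (m : ℕ) :
    ‖(((ArithmeticFunction.liouville (m + 1) : ℤ)) : ℂ)‖ = 1 := by
  rw [Complex.norm_intCast, ArithmeticFunction.liouville_apply (Nat.succ_ne_zero _)]
  push_cast
  rw [abs_pow, abs_neg, abs_one, one_pow]

/-- **Crux ⇒ stub** (`ε ↦ ε`).  `DigitalBilinearLiouville` (operator-norm form, with test vectors)
implies the pair-correlation statement `stub_twoPointDigital` of line `tt_star` verbatim: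
`‖M_π M_π^*‖_F² ≤ ‖M_π‖_op² ‖M_π‖_F² ≤ (ε 4^n) 4^n = ε 16^n`. [folklore] -/
theorem twoPointDigital_of_digitalBilinearLiouville (h : DigitalBilinearLiouville) :
    ∀ ε : ℝ, 0 < ε → ∃ n₀ : ℕ, ∀ n ≥ n₀, ∀ π : Fin n ⊕ Fin n ≃ Fin (2 * n),
      (∑ r : Fin n → Bool, ∑ r' : Fin n → Bool,
        ‖∑ c : Fin n → Bool,
          ((ArithmeticFunction.liouville
              (Nat.ofBits (fun j : Fin (2 * n) => Sum.elim r c (π.symm j)) + 1) : ℤ) : ℂ) *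
          ((ArithmeticFunction.liouville
              (Nat.ofBits (fun j : Fin (2 * n) => Sum.elim r' c (π.symm j)) + 1) : ℤ) : ℂ)‖ ^ 2) ≤
      ε * 16 ^ n := by
  intro ε hε
  obtain ⟨n₀, hn₀⟩ := h ε hε
  refine ⟨n₀, fun n hn π => ?_⟩
  set M : (Fin n → Bool) → (Fin n → Bool) → ℂ := fun r c =>
    ((ArithmeticFunction.liouville
      (Nat.ofBits (fun j : Fin (2 * n) => Sum.elim r c (π.symm j)) + 1) : ℤ) : ℂ) with hM
  have hstar : ∀ r c, star (M r c) = M r c := by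
    intro r c
    simp only [hM, Complex.star_def, map_intCast]
  have hB : ∀ (u w : (Fin n → Bool) → ℂ), ‖∑ r, ∑ c, u r * w c * M r c‖ ^ 2 ≤
      ε * 4 ^ n * (∑ r, ‖u r‖ ^ 2) * (∑ c, ‖w c‖ ^ 2) := fun u w => hn₀ n hn π u w
  have hG := gram_frobenius_sq_le_of_bilinear M (ε * 4 ^ n) (by positivity) hB
  simp only [hstar] at hG
  have hF : ∑ r' : Fin n → Bool, ∑ c : Fin n → Bool, ‖M r' c‖ ^ 2 = 4 ^ n := by
    simp only [hM, norm_liouville_succ_cast, one_pow, Finset.sum_const, Finset.card_univ,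
      Fintype.card_fun, Fintype.card_bool, Fintype.card_fin, nsmul_eq_mul, mul_one]
    push_cast
    rw [← pow_add, show (4 : ℝ) = 2 ^ 2 by norm_num, ← pow_mul, two_mul]
  have h16 : ε * 4 ^ n * (4 : ℝ) ^ n = ε * 16 ^ n := by
    rw [mul_assoc, ← mul_pow]; norm_num
  calc _ ≤ ε * 4 ^ n * ∑ r' : Fin n → Bool, ∑ c : Fin n → Bool, ‖M r' c‖ ^ 2 := hG
    _ = ε * 16 ^ n := by rw [hF, h16]

/-! ### §3 The stub implies the crux (`ε² ↦ ε`) -/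

/-- **Stub ⇒ crux** (`ε² ↦ ε`): the pair-correlation statement `stub_twoPointDigital` (verbatim, as
a hypothesis) implies `DigitalBilinearLiouville` — the kernel-checked composition of the registered
skeleton, with the landed `stub_fourthMoment`: `‖S‖⁴ ≤ ‖M M^*‖_F² ‖u‖⁴ ‖w‖⁴ ≤ ε² 16^n ‖u‖⁴ ‖w‖⁴`.
[folklore] -/
theorem digitalBilinearLiouville_of_twoPointDigital
    (h2 : ∀ ε : ℝ, 0 < ε → ∃ n₀ : ℕ, ∀ n ≥ n₀, ∀ π : Fin n ⊕ Fin n ≃ Fin (2 * n),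
      (∑ r : Fin n → Bool, ∑ r' : Fin n → Bool,
        ‖∑ c : Fin n → Bool,
          ((ArithmeticFunction.liouville
              (Nat.ofBits (fun j : Fin (2 * n) => Sum.elim r c (π.symm j)) + 1) : ℤ) : ℂ) *
          ((ArithmeticFunction.liouville
              (Nat.ofBits (fun j : Fin (2 * n) => Sum.elim r' c (π.symm j)) + 1) : ℤ) : ℂ)‖ ^ 2) ≤
      ε * 16 ^ n) :
    DigitalBilinearLiouville := by
  intro ε hε
  obtain ⟨n₀, hn₀⟩ := h2 (ε ^ 2) (by positivity)
  refine ⟨n₀, fun n hn π u w => ?_⟩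
  set M : (Fin n → Bool) → (Fin n → Bool) → ℂ := fun r c =>
    ((ArithmeticFunction.liouville
      (Nat.ofBits (fun j : Fin (2 * n) => Sum.elim r c (π.symm j)) + 1) : ℤ) : ℂ) with hM
  have hstar : ∀ r c, star (M r c) = M r c := by
    intro r c
    simp only [hM, Complex.star_def, map_intCast]
  have h2' := hn₀ n hn π
  have h4 := stub_fourthMoment M u w
  simp only [hstar] at h4
  set S : ℝ := ‖∑ r, ∑ c, u r * w c * M r c‖ with hS
  set U : ℝ := ∑ r, ‖u r‖ ^ 2 with hU
  set V : ℝ := ∑ c, ‖w c‖ ^ 2 with hV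
  set G : ℝ := ∑ r : Fin n → Bool, ∑ r' : Fin n → Bool, ‖∑ c : Fin n → Bool, M r c * M r' c‖ ^ 2
    with hG
  have hU0 : 0 ≤ U := Finset.sum_nonneg fun _ _ => by positivity
  have hV0 : 0 ≤ V := Finset.sum_nonneg fun _ _ => by positivity
  have hS0 : 0 ≤ S := norm_nonneg _
  have hG2 : G ≤ ε ^ 2 * 16 ^ n := h2'
  have hsq : (S ^ 2) ^ 2 ≤ (ε * 4 ^ n * U * V) ^ 2 := by
    have h16 : (16 : ℝ) ^ n = (4 ^ n) ^ 2 := by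
      rw [← pow_mul, show (16 : ℝ) = 4 ^ 2 by norm_num, ← pow_mul, Nat.mul_comm]
    calc (S ^ 2) ^ 2 = S ^ 4 := by ring
      _ ≤ G * U ^ 2 * V ^ 2 := h4
      _ ≤ ε ^ 2 * 16 ^ n * U ^ 2 * V ^ 2 := by gcongr
      _ = (ε * 4 ^ n * U * V) ^ 2 := by rw [h16]; ring
  have hrhs0 : 0 ≤ ε * 4 ^ n * U * V := by positivity
  have := (pow_le_pow_iff_left₀ (by positivity) hrhs0 two_ne_zero).mp hsq
  simpa [hS, hU, hV, mul_assoc] using this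

/-! ### §4 The equivalence -/

/-- **`DigitalBilinearLiouville` ⟺ `stub_twoPointDigital`** (the open stub of line `tt_star` is a
reformulation of the crux stmt-ValiantsHypothesis-14774, in test-vector-free pair-correlation
currency; `ε ↦ ε` forwards, `ε² ↦ ε` backwards). [folklore] -/
theorem digitalBilinearLiouville_iff_twoPointDigital :
    DigitalBilinearLiouville ↔
    ∀ ε : ℝ, 0 < ε → ∃ n₀ : ℕ, ∀ n ≥ n₀, ∀ π : Fin n ⊕ Fin n ≃ Fin (2 * n),
      (∑ r : Fin n → Bool, ∑ r' : Fin n → Bool,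
        ‖∑ c : Fin n → Bool,
          ((ArithmeticFunction.liouville
              (Nat.ofBits (fun j : Fin (2 * n) => Sum.elim r c (π.symm j)) + 1) : ℤ) : ℂ) *
          ((ArithmeticFunction.liouville
              (Nat.ofBits (fun j : Fin (2 * n) => Sum.elim r' c (π.symm j)) + 1) : ℤ) : ℂ)‖ ^ 2) ≤
      ε * 16 ^ n :=
  ⟨twoPointDigital_of_digitalBilinearLiouville, digitalBilinearLiouville_of_twoPointDigital⟩

end Summit.ValiantsHypothesis.ValiantsHypothesis.Theorems.LiouvilleSarnakDigitalBilinearLiouville.TtStar
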